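import Summits.ResolutionOfSingularities.ResolutionOfSingularities.Theorems.FrobeniusLadderFInjectiveMacaulayficationBlowupFiModel
import Summits.ResolutionOfSingularities.ResolutionOfSingularities.Theorems.FrobeniusLadderFInjectiveMacaulayficationStalkChartIso
import Summits.ResolutionOfSingularities.ResolutionOfSingularities.Theorems.FrobeniusLadderFInjectiveMacaulayficationDegreeZeroDescentLocal
import Literature.AlgebraicGeometry.Resolution.AffineBlowupAlgebra
import Literature.AlgebraicGeometry.Resolution.AffineBlowup
import HarnessLib

/-!
# The blow-up glue for a sub-cover of charts, affine-blowup-algebra model (crux `FInjectiveMacaulayfication`)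

Support file for crux stmt-ResolutionOfSingularities-15315 (`FrobeniusLadder.FInjectiveMacaulayfication`,
line `Sketch`, lead seat c8, cycle 9, §15 THE WEIGHTED CONE ENGINE): the registered stub
`stub_blowupFiModelOfCover`, engine E6‴ — the generalisation of the blow-up glue E6′
(`BlowupFiModel.blowupFiModel_of_maximal`) needed for weighted blow-ups, where the centre `I = I_N` has many
monomial generators but only the `n` "vertex" charts are certifiable.

Two changes with respect to E6′:

* the family `v : Fin t → I` need NOT generate `I`; instead the hypothesis
  `R[It]₊ ⊆ √(v₁t, …, v_tt)` guarantees that the charts `D₊(vⱼt)` cover `Proj R[It] = affineBlowup I`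
  (`exists_mem_basicOpen_of_irrelevant_le_radical`: a relevant homogeneous prime containing every `vⱼt` would
  contain the span, hence its radical, hence the irrelevant ideal), so every stalk of the blowing up is a local
  ring of one of the chart rings `(R[It])_{(vⱼt)}` (`exists_stalk_ringEquiv_of_cover`, via the open immersion
  `Proj.awayι` and `Spec.stalkIso`);
* the per-chart Cohen–Macaulay + Frobenius-closed hypothesis is stated for the IMAGE MODEL
  `R[I/vⱼ] = blowupAlgebra I vⱼ ⊆ R[1/vⱼ]` of the affine blowup algebra and is transported to the chart ring
  along `reesChartEquiv : (R[It])_{(vⱼt)} ≃+* R[I/vⱼ]` (`chartClause_of_blowupAlgebraClause`: maximal ideals and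
  the element `vⱼ/1` correspond, `reesChartEquiv_reesChartBase`, and local rings at corresponding primes are
  isomorphic, `nonempty_ringEquiv_localization_of_ringEquiv`).

Then `stub_blowupFiModelOfCover` concludes exactly as E6′: `X' = affineBlowup I` (proper, birational for
`I ≠ 0`), and at every point the stalk clause follows from `BlowupFiModel.chart_fiClause_of_maximal`.

References: The Stacks Project, Tag 0804 (the affine blowup algebras cover the blowing up), Tag 052Q/07Z3
(`R[I/a]`); R. Hartshorne, *Algebraic Geometry*, Prop. II.2.5; the rest is folklore.
-/

-- single-problem summit: the doubled namespace component is forced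
set_option linter.dupNamespace false

noncomputable section

namespace Summit.ResolutionOfSingularities.ResolutionOfSingularities.Theorems.FInjectiveMacaulayfication.BlowupFiModelOfCover

open AlgebraicGeometry CategoryTheory Literature.AlgebraicGeometry.Resolution

/-! ## §1 The charts of a radical sub-cover cover the blowing up -/

/-- **A radical sub-cover covers**: if the irrelevant ideal `R[It]₊` lies in the radical of
`(v₁t, …, v_tt)`, then every point of `Proj R[It] = affineBlowup I` lies in some chart `D₊(vⱼt)` (a relevant
homogeneous prime cannot contain all the `vⱼt`: it would contain their span, hence its radical, hence
`R[It]₊`). [cite: StacksProject, Tag 0804] -/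
theorem exists_mem_basicOpen_of_irrelevant_le_radical {R : Type*} [CommRing R] {I : Ideal R} {t : ℕ}
    (v : Fin t → R) (hv : ∀ j : Fin t, v j ∈ I)
    (hcov : (HomogeneousIdeal.irrelevant (reesGrading I)).toIdeal ≤
      (Ideal.span (Set.range fun j : Fin t => reesT (I := I) (v j) (hv j))).radical)
    (y : ↥(affineBlowup I)) :
    ∃ j : Fin t, y ∈ Proj.basicOpen (reesGrading I) (reesT (v j) (hv j)) := by
  by_contra! H
  simp only [Proj.mem_basicOpen, not_not] at H
  refine y.not_irrelevant_le (hcov.trans ?_)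
  refine (Ideal.IsPrime.radical_le_iff y.isPrime).mpr ?_
  rw [Ideal.span_le, Set.range_subset_iff]
  exact H

/-- **Stalks of the blowing up are local rings of the charts of a radical sub-cover**: under the cover
hypothesis `R[It]₊ ⊆ √(v₁t, …, v_tt)`, every point `y` of `affineBlowup I` lies in some `D₊(vⱼt)`, and its stalk
is ring-isomorphic to the localization of the chart ring `(R[It])_{(vⱼt)}` at the prime `q` corresponding to
`y` under the open immersion `Proj.awayι : Spec (R[It])_{(vⱼt)} ⟶ Proj R[It]` (range `D₊(vⱼt)`,
`Proj.opensRange_awayι`; stalk maps of open immersions are isomorphisms; `Spec.stalkIso`).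
[cite: StacksProject, Tag 0804] -/
theorem exists_stalk_ringEquiv_of_cover {R : Type} [CommRing R] {I : Ideal R} {t : ℕ}
    (v : Fin t → R) (hv : ∀ j : Fin t, v j ∈ I)
    (hcov : (HomogeneousIdeal.irrelevant (reesGrading I)).toIdeal ≤
      (Ideal.span (Set.range fun j : Fin t => reesT (I := I) (v j) (hv j))).radical)
    (y : ↥(affineBlowup I)) :
    ∃ (j : Fin t) (q : PrimeSpectrum (HomogeneousLocalization.Away (reesGrading I) (reesT (v j) (hv j)))),
      Nonempty (((affineBlowup I).presheaf.stalk y) ≃+* Localization.AtPrime q.asIdeal) := by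
  obtain ⟨j, hj⟩ := exists_mem_basicOpen_of_irrelevant_le_radical v hv hcov y
  rw [← Proj.opensRange_awayι (reesGrading I) (reesT (v j) (hv j)) (reesT_mem (v j) (hv j)) Nat.one_pos]
    at hj
  obtain ⟨q, rfl⟩ := Scheme.Hom.mem_opensRange.mp hj
  exact ⟨j, q, ⟨((asIso ((Proj.awayι (reesGrading I) (reesT (v j) (hv j)) (reesT_mem (v j) (hv j))
    Nat.one_pos).stalkMap q)).commRingCatIsoToRingEquiv).trans
      (Spec.stalkIso (.of (HomogeneousLocalization.Away (reesGrading I) (reesT (v j) (hv j)))) q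
        ).commRingCatIsoToRingEquiv⟩⟩

/-! ## §2 Transport of the chart clause along `(R[It])_{(at)} ≅ R[I/a]` -/

/-- Local rings at corresponding primes of isomorphic rings are isomorphic: for `e : A ≃+* B` and primes
`Q ⊆ A`, `Q' ⊆ B` with `e⁻¹(Q') = Q`, `A_Q ≅ B_{Q'}`. [folklore] -/
theorem nonempty_ringEquiv_localization_of_ringEquiv {A B : Type*} [CommRing A] [CommRing B] (e : A ≃+* B)
    (Q : Ideal A) (Q' : Ideal B) [Q.IsPrime] [Q'.IsPrime] (h : ∀ x : A, e x ∈ Q' ↔ x ∈ Q) :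
    Nonempty (Localization.AtPrime Q ≃+* Localization.AtPrime Q') := by
  have hmap : Q.primeCompl.map e.toMonoidHom = Q'.primeCompl := by
    ext y
    simp only [Submonoid.mem_map, Ideal.mem_primeCompl_iff]
    constructor
    · rintro ⟨x, hx, rfl⟩
      exact fun hy => hx ((h x).mp hy)
    · intro hy
      refine ⟨e.symm y, fun hx => hy ?_, ?_⟩
      · have := (h (e.symm y)).mpr hx
        rwa [e.apply_symm_apply] at this
      · change e (e.symm y) = y
        exact e.apply_symm_apply y
  exact ⟨IsLocalization.ringEquivOfRingEquiv (M := Q.primeCompl) (T := Q'.primeCompl)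
    (Localization.AtPrime Q) (Localization.AtPrime Q') e hmap⟩

/-- **The chart clause in the image model transports to the chart ring**: if the affine blowup algebra
`R[I/a] = blowupAlgebra I a ⊆ R[1/a]` satisfies the Cohen–Macaulay + Frobenius-closed clause at its maximal
ideals containing `a`, then the chart ring `(R[It])_{(at)}` satisfies it at its maximal ideals containing
`a/1` — transport along `reesChartEquiv : (R[It])_{(at)} ≃+* R[I/a]`, which carries `a/1` to `a`
(`reesChartEquiv_reesChartBase`), a maximal `Q` to the maximal `e(Q)`, and `A_Q` onto `R[I/a]_{e(Q)}`.
[folklore] -/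
theorem chartClause_of_blowupAlgebraClause (p : ℕ) {R : Type} [CommRing R] {I : Ideal R} (a : R) (ha : a ∈ I)
    (hon : ∀ (Q : Ideal (blowupAlgebra I a)) [Q.IsMaximal], algebraMap R (blowupAlgebra I a) a ∈ Q →
      ∀ d : ℕ, ringKrullDim (Localization.AtPrime Q) = d → ∀ s : Fin d → Localization.AtPrime Q,
        (Ideal.span (Set.range s)).radical.IsMaximal →
          RingTheory.Sequence.IsWeaklyRegular (Localization.AtPrime Q) (List.ofFn s) ∧
          ∀ y : Localization.AtPrime Q, (∃ e : ℕ, y ^ p ^ e ∈ Ideal.span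
            ((fun z : Localization.AtPrime Q => z ^ p ^ e) ''
              (Ideal.span (Set.range s) : Set (Localization.AtPrime Q)))) → y ∈ Ideal.span (Set.range s))
    (Q : Ideal (HomogeneousLocalization.Away (reesGrading I) (reesT a ha))) [Q.IsMaximal]
    (haQ : reesChartBase (I := I) a ha a ∈ Q) :
    ∀ d : ℕ, ringKrullDim (Localization.AtPrime Q) = d → ∀ s : Fin d → Localization.AtPrime Q,
      (Ideal.span (Set.range s)).radical.IsMaximal →
        RingTheory.Sequence.IsWeaklyRegular (Localization.AtPrime Q) (List.ofFn s) ∧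
        ∀ y : Localization.AtPrime Q, (∃ e : ℕ, y ^ p ^ e ∈ Ideal.span
          ((fun z : Localization.AtPrime Q => z ^ p ^ e) ''
            (Ideal.span (Set.range s) : Set (Localization.AtPrime Q)))) → y ∈ Ideal.span (Set.range s) := by
  -- `Q' = e(Q)` is maximal and contains `a = e(a/1)`
  have hmem : algebraMap R (blowupAlgebra I a) a ∈ Q.map (reesChartEquiv a ha) := by
    rw [← reesChartEquiv_reesChartBase a ha a, Ideal.apply_mem_of_equiv_iff]
    exact haQ
  have hQ' := hon (Q.map (reesChartEquiv a ha)) hmem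
  -- `A_Q ≅ R[I/a]_{e(Q)}`
  obtain ⟨eL⟩ := nonempty_ringEquiv_localization_of_ringEquiv (reesChartEquiv a ha) Q
    (Q.map (reesChartEquiv a ha)) fun x => Ideal.apply_mem_of_equiv_iff
  exact DegreeZeroDescent.inlineClause_of_ringEquiv p eL.symm hQ'

/-! ## §3 The stub -/

/-- **E6‴ THE BLOW-UP GLUE FOR A SUB-COVER OF CHARTS** (affine-blowup-algebra model; registered stub
`stub_blowupFiModelOfCover` of crux stmt-ResolutionOfSingularities-15315, line `Sketch`): `R` a Noetherian
domain of characteristic `p`, `I ≠ 0`, `v₁,…,v_t ∈ I` non-zero such that the `vⱼ t` generate an ideal of the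
Rees algebra whose radical contains the irrelevant ideal (the charts `D₊(vⱼt)` cover `Bl_I`). If `R_P` satisfies
the full clause at every prime `P ⊉ I` and every affine blowup algebra `R[I/vⱼ] ⊆ R[1/vⱼ]` satisfies the
Cohen–Macaulay + Frobenius-closed clause at its maximal ideals containing `vⱼ`, then `Spec R` admits the crux's
model (`X' = affineBlowup I`). Generalises E6′ `BlowupFiModel.blowupFiModel_of_maximal` (all generators ↦ any
covering sub-family; chart ring ↦ `blowupAlgebra` via `reesChartEquiv`). [cite: StacksProject, Tag 0804] -/
theorem stub_blowupFiModelOfCover : ∀ (p : ℕ) [Fact p.Prime] (R : Type) [CommRing R] [IsDomain R] [IsNoetherianRing R]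
    [CharP R p] (I : Ideal R) (t : ℕ) (v : Fin t → R) (hv : ∀ j : Fin t, v j ∈ I), I ≠ ⊥ → (∀ j : Fin t, v j ≠ 0) →
    (HomogeneousIdeal.irrelevant (reesGrading I)).toIdeal ≤
      (Ideal.span (Set.range fun j : Fin t => reesT (I := I) (v j) (hv j))).radical →
    (∀ (P : Ideal R) [P.IsPrime], ¬ I ≤ P →
      IsDomain (Localization.AtPrime P) ∧
      ∀ d : ℕ, ringKrullDim (Localization.AtPrime P) = d → ∀ s : Fin d → Localization.AtPrime P,
        (Ideal.span (Set.range s)).radical.IsMaximal →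
          RingTheory.Sequence.IsWeaklyRegular (Localization.AtPrime P) (List.ofFn s) ∧
          ∀ y : Localization.AtPrime P, (∃ e : ℕ, y ^ p ^ e ∈ Ideal.span
            ((fun z : Localization.AtPrime P => z ^ p ^ e) ''
              (Ideal.span (Set.range s) : Set (Localization.AtPrime P)))) → y ∈ Ideal.span (Set.range s)) →
    (∀ (j : Fin t) (Q : Ideal (Literature.AlgebraicGeometry.Resolution.blowupAlgebra I (v j))) [Q.IsMaximal],
      algebraMap R (Literature.AlgebraicGeometry.Resolution.blowupAlgebra I (v j)) (v j) ∈ Q →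
      ∀ d : ℕ, ringKrullDim (Localization.AtPrime Q) = d → ∀ s : Fin d → Localization.AtPrime Q,
        (Ideal.span (Set.range s)).radical.IsMaximal →
          RingTheory.Sequence.IsWeaklyRegular (Localization.AtPrime Q) (List.ofFn s) ∧
          ∀ y : Localization.AtPrime Q, (∃ e : ℕ, y ^ p ^ e ∈ Ideal.span
            ((fun z : Localization.AtPrime Q => z ^ p ^ e) ''
              (Ideal.span (Set.range s) : Set (Localization.AtPrime Q)))) → y ∈ Ideal.span (Set.range s)) →
    ∃ (X' : Scheme.{0}) (π : X' ⟶ Spec (.of R)), IsProper π ∧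
      Literature.AlgebraicGeometry.Resolution.IsBirational π ∧
      ∀ y : X', IsDomain (X'.presheaf.stalk y) ∧ ∀ d : ℕ, ringKrullDim (X'.presheaf.stalk y) = d →
        ∀ s : Fin d → X'.presheaf.stalk y, (Ideal.span (Set.range s)).radical.IsMaximal →
          RingTheory.Sequence.IsWeaklyRegular (X'.presheaf.stalk y) (List.ofFn s) ∧
          ∀ z : X'.presheaf.stalk y, (∃ e : ℕ, z ^ p ^ e ∈
              Ideal.span ((fun w : X'.presheaf.stalk y => w ^ p ^ e) ''
                (Ideal.span (Set.range s) : Set (X'.presheaf.stalk y)))) →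
            z ∈ Ideal.span (Set.range s) := by
  intro p _ R _ _ _ _ I t v hv hI hv0 hcov hoff hon
  refine ⟨affineBlowup I, affineBlowup.π I, inferInstance, affineBlowup.isBirational hI, fun y => ?_⟩
  obtain ⟨j, q, ⟨e⟩⟩ := exists_stalk_ringEquiv_of_cover v hv hcov y
  have hoff' : ∀ (P : Ideal R) [P.IsPrime], v j ∉ P →
      IsDomain (Localization.AtPrime P) ∧
      ∀ d : ℕ, ringKrullDim (Localization.AtPrime P) = d → ∀ s : Fin d → Localization.AtPrime P,
        (Ideal.span (Set.range s)).radical.IsMaximal →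
          RingTheory.Sequence.IsWeaklyRegular (Localization.AtPrime P) (List.ofFn s) ∧
          ∀ y : Localization.AtPrime P, (∃ e : ℕ, y ^ p ^ e ∈ Ideal.span
            ((fun z : Localization.AtPrime P => z ^ p ^ e) ''
              (Ideal.span (Set.range s) : Set (Localization.AtPrime P)))) → y ∈ Ideal.span (Set.range s) :=
    fun P _ hxP => hoff P fun hle => hxP (hle (hv j))
  obtain ⟨hdom, hq⟩ := BlowupFiModel.chart_fiClause_of_maximal p (v j) (hv j) (hv0 j) hoff'
    (fun Q _ haQ => chartClause_of_blowupAlgebraClause p (v j) (hv j) (hon j) Q haQ) q.asIdeal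
  haveI := hdom
  exact ⟨MulEquiv.isDomain (Localization.AtPrime q.asIdeal) e.toMulEquiv,
    DegreeZeroDescent.inlineClause_of_ringEquiv p e.symm hq⟩

end Summit.ResolutionOfSingularities.ResolutionOfSingularities.Theorems.FInjectiveMacaulayfication.BlowupFiModelOfCover

end
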